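import Summits.NavierStokesRegularity.FunctionalMining.PidevMomentRate
import Summits.NavierStokesRegularity.FunctionalMining.GradPressureMomentRateRpow
import Summits.NavierStokesRegularity.FunctionalMining.StrainFlat
import HarnessLib

/-!
# FunctionalMining — `∫|Π^dev|^q` at every real `q > 1`: the exact rate along classical solutions

Search for candidate a priori estimates; no regularity claim. Cell `pub-nsfunc`, prove seat
(gen 11). K0 family `EP.Pidev.q` (rows `EP.Pidev.q=3/2`, `σ_F = 3, γ_F = 2`, and `EP.Pidev.q=2`,
`σ_F = 5, γ_F = 9/5`): for the deviatoric pressure-Hessian moment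
`torusPidevMoment q v = ∫ (∑ᵢⱼ (Π^dev_v)ᵢⱼ²)^{q/2}` (`PidevMomentRate`) and every REAL `q > 1`, along
every classical unforced solution on `T^d × [a, b]`,

`d/dt ∫|Π^dev|^q = ∫ q|Π^dev|^{q−2} ∑ᵢⱼ Π^devᵢⱼ (∂ₜΠ^dev)ᵢⱼ = N_q + ν V_q`,
`V_q(v) = ∫ q|Π^dev_v|^{q−2} ∑ᵢⱼ Π^devᵢⱼ D²_dev(Δ⁻¹A_v)ᵢⱼ`, `N_q` the same with `B_v`

(`∂ₜπ = Δ⁻¹(νA_v + B_v)`; `D²_dev θ = ∇²θ − (Δθ/n) I` is `hessDev θ`). As for `∫‖∇π‖^q`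
(`GradPressureMomentRateRpow`) the weight `M ↦ ‖M‖^q` on `ℝ^{d×d}` is only `C¹`, so the entries
`Π^devᵢⱼ` are packaged as ONE map `pidevFlat v : T^d → EuclideanSpace ℝ (d × d)` (pattern of
`StrainFlat`) and the time derivative is taken with the vector-valued `C¹`-weight tool
`C1Weight.hasDerivWithinAt_integral_comp_fderiv` (`C1WeightIntegralVec`). Packaged as
`HasInitialRate (torusPidevMoment q) N_q V_q` for the heat sieve (`HeatSieve`); the integrand of `V_q` is
continuous for smooth data (`continuous_pidevRpowIntegrand`). Identities along smooth solutions only.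
-/

noncomputable section

open MeasureTheory Finset Set Filter Topology
open scoped InnerProductSpace RealInnerProductSpace ContDiff

namespace Summit.NavierStokesRegularity.FunctionalMining

open Literature.Analysis.FunctionSpaces Literature.Analysis.FluidPDE

variable {d : Type*} [Fintype d] [DecidableEq d]

/-! ## 1. The deviatoric Hessian of a scalar and the flattened deviator -/

/-- **The deviatoric Hessian of a scalar** `(D²_dev θ)ᵢⱼ = ∂ᵢ∂ⱼθ − δᵢⱼ (∑ₖ∂ₖ∂ₖθ)/n`, `n = #d`
(so that `Π^dev_v = D²_dev π_v`, `pidev_eq_hessDev`). [ours; bookkeeping] -/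
def hessDev (θ : UnitAddTorus d → ℝ) (i j : d) (x : UnitAddTorus d) : ℝ :=
  Torus.partialDeriv i (Torus.partialDeriv j θ) x -
    (if i = j then (1 : ℝ) else 0) *
      ((∑ k, Torus.partialDeriv k (Torus.partialDeriv k θ) x) / (Fintype.card d : ℝ))

/-- `Π^dev_v = D²_dev π_v`. [ours] -/
theorem pidev_eq_hessDev (v : UnitAddTorus d → EuclideanSpace ℝ d) (i j : d) (x : UnitAddTorus d) :
    pidev v i j x = hessDev (pressureOf v) i j x := rfl

/-- The deviatoric Hessian of a scalar as a map into `EuclideanSpace ℝ (d × d)`. [ours; packaging] -/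
def hessDevFlat (θ : UnitAddTorus d → ℝ) (x : UnitAddTorus d) : EuclideanSpace ℝ (d × d) :=
  WithLp.toLp 2 fun p => hessDev θ p.1 p.2 x

/-- Entries of the flattened deviatoric Hessian. [ours] -/
@[simp] theorem hessDevFlat_apply (θ : UnitAddTorus d → ℝ) (x : UnitAddTorus d) (p : d × d) :
    hessDevFlat θ x p = hessDev θ p.1 p.2 x := rfl

/-- **The flattened deviator** `pidevFlat v x (i, j) = (Π^dev_v)ᵢⱼ(x)`. [ours; packaging] -/
def pidevFlat (v : UnitAddTorus d → EuclideanSpace ℝ d) (x : UnitAddTorus d) : EuclideanSpace ℝ (d × d) :=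
  hessDevFlat (pressureOf v) x

/-- Entries of the flattened deviator. [ours] -/
@[simp] theorem pidevFlat_apply (v : UnitAddTorus d → EuclideanSpace ℝ d) (x : UnitAddTorus d) (p : d × d) :
    pidevFlat v x p = pidev v p.1 p.2 x := rfl

/-- `‖pidevFlat v x‖² = ∑ᵢⱼ (Π^dev)ᵢⱼ²`. [ours] -/
theorem norm_pidevFlat_sq (v : UnitAddTorus d → EuclideanSpace ℝ d) (x : UnitAddTorus d) :
    ‖pidevFlat v x‖ ^ 2 = ∑ i, ∑ j, pidev v i j x ^ 2 := by
  rw [EuclideanCoord.norm_sq_eq_sum_sq, Fintype.sum_prod_type]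
  rfl

/-- `(∑ᵢⱼ (Π^dev)ᵢⱼ²)^{r/2} = ‖pidevFlat v x‖^r`. [ours] -/
theorem sum_pidev_sq_rpow (v : UnitAddTorus d → EuclideanSpace ℝ d) (x : UnitAddTorus d) (r : ℝ) :
    (∑ i, ∑ j, pidev v i j x ^ 2) ^ (r / 2) = ‖pidevFlat v x‖ ^ r := by
  rw [← norm_pidevFlat_sq, ← Real.rpow_natCast, ← Real.rpow_mul (norm_nonneg _)]
  congr 1
  push_cast
  ring

/-- The functional through the flattened deviator: `∫|Π^dev|^q = ∫ ‖pidevFlat v‖^q`. [ours] -/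
theorem torusPidevMoment_eq_integral_norm_rpow (q : ℝ) (v : UnitAddTorus d → EuclideanSpace ℝ d) :
    torusPidevMoment q v = ∫ x, ‖pidevFlat v x‖ ^ q := by
  unfold torusPidevMoment
  exact integral_congr_ae (ae_of_all _ fun x => sum_pidev_sq_rpow v x q)

/-- `⟪pidevFlat v x, hessDevFlat θ x⟫ = ∑ᵢⱼ Π^devᵢⱼ (D²_dev θ)ᵢⱼ`. [ours] -/
theorem inner_pidevFlat_hessDevFlat (v : UnitAddTorus d → EuclideanSpace ℝ d) (θ : UnitAddTorus d → ℝ)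
    (x : UnitAddTorus d) :
    ⟪pidevFlat v x, hessDevFlat θ x⟫_ℝ = ∑ i, ∑ j, pidev v i j x * hessDev θ i j x := by
  rw [PiLp.inner_apply, Fintype.sum_prod_type]
  refine Finset.sum_congr rfl fun i _ => Finset.sum_congr rfl fun j _ => ?_
  simp [mul_comm]

/-- `D²_dev θ` has smooth entries for smooth `θ`. [folklore] -/
theorem isSmooth_hessDev {θ : UnitAddTorus d → ℝ} (hθ : Torus.IsSmooth θ) (i j : d) :
    Torus.IsSmooth (hessDev θ i j) := by
  have hL : Torus.IsSmooth (fun x => ∑ k, Torus.partialDeriv k (Torus.partialDeriv k θ) x) := by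
    unfold Torus.IsSmooth
    exact ContDiff.sum fun k _ => (hθ.partialDeriv k).partialDeriv k
  exact ((hθ.partialDeriv j).partialDeriv i).sub ((Torus.isSmooth_const _).mul
    (hL.mul (Torus.isSmooth_const _)))

/-- `hessDevFlat θ` is smooth for smooth `θ`. [folklore] -/
theorem isSmooth_hessDevFlat {θ : UnitAddTorus d → ℝ} (hθ : Torus.IsSmooth θ) :
    Torus.IsSmooth (hessDevFlat θ) :=
  EuclideanCoord.isSmooth_of_coord fun p => by
    simpa only [hessDevFlat_apply] using isSmooth_hessDev hθ p.1 p.2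

/-- `D²_dev` is linear: `D²_dev(c f + g) = c D²_dev f + D²_dev g` for smooth `f, g`. [folklore] -/
theorem hessDev_const_smul_add {f g : UnitAddTorus d → ℝ} (hf : Torus.IsSmooth f) (hg : Torus.IsSmooth g)
    (c : ℝ) (i j : d) (x : UnitAddTorus d) :
    hessDev (c • f + g) i j x = c * hessDev f i j x + hessDev g i j x := by
  have h1 : ∀ k, Torus.partialDeriv k (c • f + g) = c • Torus.partialDeriv k f + Torus.partialDeriv k g := by
    intro k
    rw [Torus.partialDeriv_add ((hf.isContDiff (by simp)).smul c) (hg.isContDiff (by simp)),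
      Torus.partialDeriv_const_smul (hf.isContDiff (by simp))]
  have h2 : ∀ l k y, Torus.partialDeriv l (Torus.partialDeriv k (c • f + g)) y =
      c * Torus.partialDeriv l (Torus.partialDeriv k f) y + Torus.partialDeriv l (Torus.partialDeriv k g) y := by
    intro l k y
    rw [h1 k, Torus.partialDeriv_add (((hf.partialDeriv k).isContDiff (by simp)).smul c)
      ((hg.partialDeriv k).isContDiff (by simp)),
      Torus.partialDeriv_const_smul ((hf.partialDeriv k).isContDiff (by simp))]
    simp [smul_eq_mul]
  simp only [hessDev, h2, Finset.sum_add_distrib, ← Finset.mul_sum]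
  ring

omit [DecidableEq d] in
/-- A space–time field with values in `EuclideanSpace ℝ ι` whose coordinates are jointly smooth is
jointly smooth. [folklore] -/
theorem isSmoothSpaceTimeOn_of_coord {ι : Type*} [Fintype ι] {S : Set ℝ}
    {w : ℝ → UnitAddTorus d → EuclideanSpace ℝ ι}
    (h : ∀ p, Torus.IsSmoothSpaceTimeOn S (fun s x => w s x p)) : Torus.IsSmoothSpaceTimeOn S w := by
  unfold Torus.IsSmoothSpaceTimeOn
  exact contDiffOn_euclidean.2 fun p => h p

/-- A vector of `EuclideanSpace ℝ ι` is the sum of its coordinates times the standard basis. [folklore] -/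
theorem eq_sum_smul_single {ι : Type*} [Fintype ι] [DecidableEq ι] (w : EuclideanSpace ℝ ι) :
    w = ∑ p, w p • EuclideanSpace.single p (1 : ℝ) := by
  conv_lhs => rw [← (EuclideanSpace.basisFun ι ℝ).sum_repr w]
  simp

/-! ## 2. The rates -/

/-- **Viscous (heat-flow) rate of `∫|Π^dev|^q`**:
`V_q(v) = ∫ q (∑ᵢⱼ(Π^dev)ᵢⱼ²)^{(q−2)/2} ∑ᵢⱼ Π^devᵢⱼ (D²_dev Δ⁻¹A_v)ᵢⱼ`. [ours; bookkeeping] -/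
def pidevRpowViscousRate (q : ℝ) (v : UnitAddTorus d → EuclideanSpace ℝ d) : ℝ :=
  ∫ x, q * (∑ i, ∑ j, pidev v i j x ^ 2) ^ ((q - 2) / 2) *
    ∑ i, ∑ j, pidev v i j x * hessDev (Torus.invLaplacian (pressureSqViscousSource v)) i j x

/-- **Inertial rate of `∫|Π^dev|^q`**: the same with `B_v`. [ours; bookkeeping] -/
def pidevRpowInertialRate (q : ℝ) (v : UnitAddTorus d → EuclideanSpace ℝ d) : ℝ :=
  ∫ x, q * (∑ i, ∑ j, pidev v i j x ^ 2) ^ ((q - 2) / 2) *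
    ∑ i, ∑ j, pidev v i j x * hessDev (Torus.invLaplacian (pressureSqInertialSource v)) i j x

/-- The integrand of the rates is the derivative of the `C¹` weight:
`q (∑Π²)^{(q−2)/2} ∑ Πᵢⱼ Dᵢⱼ = D(‖·‖^q)(pidevFlat v x)[hessDevFlat θ x]`, `q > 1`. [ours] -/
theorem pidevRpowIntegrand_eq_fderiv {q : ℝ} (hq : 1 < q) (v : UnitAddTorus d → EuclideanSpace ℝ d)
    (θ : UnitAddTorus d → ℝ) (x : UnitAddTorus d) :
    q * (∑ i, ∑ j, pidev v i j x ^ 2) ^ ((q - 2) / 2) * ∑ i, ∑ j, pidev v i j x * hessDev θ i j x =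
      fderiv ℝ (fun w : EuclideanSpace ℝ (d × d) => ‖w‖ ^ q) (pidevFlat v x) (hessDevFlat θ x) := by
  rw [fderiv_norm_rpow_apply' hq, sum_pidev_sq_rpow, inner_pidevFlat_hessDevFlat]

/-- **The integrand of the rates is continuous** for smooth `v`, `θ` and `q > 1` (although
`(∑Π²)^{(q−2)/2}` alone is not, for `q < 2`). [ours] -/
theorem continuous_pidevRpowIntegrand {q : ℝ} (hq : 1 < q) {v : UnitAddTorus d → EuclideanSpace ℝ d}
    (hv : Torus.IsSmooth v) {θ : UnitAddTorus d → ℝ} (hθ : Torus.IsSmooth θ) :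
    Continuous fun x => q * (∑ i, ∑ j, pidev v i j x ^ 2) ^ ((q - 2) / 2) *
      ∑ i, ∑ j, pidev v i j x * hessDev θ i j x := by
  simp_rw [pidevRpowIntegrand_eq_fderiv hq]
  exact (((contDiff_norm_rpow hq).continuous_fderiv one_ne_zero).comp
    (isSmooth_hessDevFlat (isSmooth_pressureOf hv)).continuous).clm_apply (isSmooth_hessDevFlat hθ).continuous

/-! ## 3. The exact rate -/

/-- **`d/dt ∫|Π^dev|^q = N_q + νV_q` along classical unforced solutions on `T^d`, real `q > 1`.**
[ours] -/
theorem hasDerivWithinAt_torusPidevMoment_rpow [Nonempty d] {q : ℝ} (hq : 1 < q)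
    {a b ν : ℝ} {u : ℝ → UnitAddTorus d → EuclideanSpace ℝ d} {p : ℝ → UnitAddTorus d → ℝ}
    (h : Torus.IsClassicalNSSolutionOn (Icc a b) ν 0 u p) (hab : a < b) {t : ℝ} (ht : t ∈ Icc a b) :
    HasDerivWithinAt (fun s => torusPidevMoment q (u s))
      (pidevRpowInertialRate q (u t) + ν * pidevRpowViscousRate q (u t)) (Icc a b) t := by
  have hU : UniqueDiffOn ℝ (Icc a b) := uniqueDiffOn_Icc hab
  have hint : (interior (Icc a b)).Nonempty := by
    rw [interior_Icc]; exact nonempty_Ioo.2 hab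
  have hu : Torus.IsSmoothSpaceTimeOn (Icc a b) u := h.smooth_velocity
  have hus : ∀ s ∈ Icc a b, Torus.IsSmooth (u s) := fun s hs => hu.isSmooth_slice hs
  have hut : Torus.IsSmooth (u t) := hus t ht
  have hσ : Torus.IsSmoothSpaceTimeOn (Icc a b) (fun s x => -gradSqTrace (u s) x) := by
    have h1 : Torus.IsSmoothSpaceTimeOn (Icc a b) (fun s x => gradSqTrace (u s) x) :=
      Torus.IsSmoothSpaceTimeOn.sum fun i _ => Torus.IsSmoothSpaceTimeOn.sum fun j _ =>
        ((hu.partialDeriv hU i).apply j).mul ((hu.partialDeriv hU j).apply i)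
    exact h1.neg
  have hP : Torus.IsSmoothSpaceTimeOn (Icc a b) (fun s => pressureOf (u s)) :=
    hσ.invLaplacian (convex_Icc a b) hint
  have hπ : Torus.IsSmooth (pressureOf (u t)) := isSmooth_pressureOf hut
  -- joint smoothness of the entries of `Π^dev` and of the flattened deviator
  have hH : ∀ i j, Torus.IsSmoothSpaceTimeOn (Icc a b)
      (fun s => Torus.partialDeriv i (Torus.partialDeriv j (pressureOf (u s)))) :=
    fun i j => (hP.partialDeriv hU j).partialDeriv hU i
  have hE : ∀ i j, Torus.IsSmoothSpaceTimeOn (Icc a b) (fun s x => pidev (u s) i j x) := by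
    intro i j
    exact (hH i j).sub ((Torus.isSmoothSpaceTimeOn_const (Torus.isSmooth_const _) _).mul
      ((Torus.IsSmoothSpaceTimeOn.sum fun k _ => hH k k).mul
        (Torus.isSmoothSpaceTimeOn_const (Torus.isSmooth_const _) _)))
  have hθ : Torus.IsSmoothSpaceTimeOn (Icc a b) (fun s => pidevFlat (u s)) :=
    isSmoothSpaceTimeOn_of_coord fun p => by simpa only [pidevFlat_apply] using hE p.1 p.2
  -- `W = ∂ₜπ = Δ⁻¹(νA + B)`
  set W : UnitAddTorus d → ℝ := Torus.timeDerivWithin (Icc a b) (fun s => pressureOf (u s)) t with hW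
  have hA : Torus.IsSmooth (pressureSqViscousSource (u t)) := isSmooth_pressureSqViscousSource hut
  have hB : Torus.IsSmooth (pressureSqInertialSource (u t)) := isSmooth_pressureSqInertialSource hut
  set GA : UnitAddTorus d → ℝ := Torus.invLaplacian (pressureSqViscousSource (u t)) with hGA
  set GB : UnitAddTorus d → ℝ := Torus.invLaplacian (pressureSqInertialSource (u t)) with hGB
  have hGAs : Torus.IsSmooth GA := Torus.isSmooth_invLaplacian hA
  have hGBs : Torus.IsSmooth GB := Torus.isSmooth_invLaplacian hB
  have hWeq : W = ν • GA + GB := by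
    have e3 : W = Torus.invLaplacian
        (fun x => ν * pressureSqViscousSource (u t) x + pressureSqInertialSource (u t) x) := by
      funext x
      have e4 : Torus.timeDerivWithin (Icc a b) (fun s => pressureOf (u s)) t x =
          Torus.invLaplacian (Torus.timeDerivWithin (Icc a b) (fun s y => -gradSqTrace (u s) y) t) x :=
        Torus.timeDerivWithin_invLaplacian hab hσ ht x
      rw [hW, e4, timeDerivWithin_neg_gradSqTrace h hab ht]
    have e5 : (fun x => ν * pressureSqViscousSource (u t) x + pressureSqInertialSource (u t) x) =
        ν • pressureSqViscousSource (u t) + pressureSqInertialSource (u t) := by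
      funext x; simp [smul_eq_mul]
    rw [e3, e5, Torus.invLaplacian_add (hA.smul ν) hB, Torus.invLaplacian_const_smul ν _ hA]
  -- the time derivative of the entries: `∂ₜ Π^devᵢⱼ = (D²_dev W)ᵢⱼ`
  have hD2 : ∀ i j x, HasDerivWithinAt (fun s => Torus.partialDeriv i (Torus.partialDeriv j (pressureOf (u s))) x)
      (Torus.partialDeriv i (Torus.partialDeriv j W) x) (Icc a b) t := by
    intro i j x
    have h0 := (hH i j).hasDerivWithinAt_slice ht x
    have e1 : Torus.timeDerivWithin (Icc a b)
        (fun s => Torus.partialDeriv i (Torus.partialDeriv j (pressureOf (u s)))) t x =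
        Torus.partialDeriv i (Torus.partialDeriv j W) x := by
      rw [Torus.timeDerivWithin_partialDeriv_comm hab (hP.partialDeriv hU j) ht i x]
      congr 1
      funext y
      exact Torus.timeDerivWithin_partialDeriv_comm hab hP ht j y
    rw [e1] at h0
    exact h0
  have hDE : ∀ i j x, HasDerivWithinAt (fun s => pidev (u s) i j x) (hessDev W i j x) (Icc a b) t := by
    intro i j x
    have h1 := hD2 i j x
    have h2 := HasDerivWithinAt.fun_sum (u := Finset.univ) fun k _ => hD2 k k x
    exact h1.sub ((h2.div_const (Fintype.card d : ℝ)).const_mul _)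
  have hDθ : ∀ x, Torus.timeDerivWithin (Icc a b) (fun s => pidevFlat (u s)) t x = hessDevFlat W x := by
    intro x
    have h2 : HasDerivWithinAt
        (fun s => ∑ p : d × d, pidev (u s) p.1 p.2 x • EuclideanSpace.single p (1 : ℝ))
        (∑ p : d × d, hessDev W p.1 p.2 x • EuclideanSpace.single p (1 : ℝ)) (Icc a b) t :=
      HasDerivWithinAt.fun_sum (u := Finset.univ) fun p _ => (hDE p.1 p.2 x).smul_const _
    have h3 : HasDerivWithinAt (fun s => pidevFlat (u s) x) (hessDevFlat W x) (Icc a b) t := by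
      rw [eq_sum_smul_single (hessDevFlat W x)]
      refine h2.congr (fun s _ => ?_) ?_
      · rw [eq_sum_smul_single (pidevFlat (u s) x)]; rfl
      · rw [eq_sum_smul_single (pidevFlat (u t) x)]; rfl
    rw [Torus.timeDerivWithin, h3.derivWithin (hU t ht)]
  have hHW : ∀ x, hessDevFlat W x = ν • hessDevFlat GA x + hessDevFlat GB x := by
    intro x
    ext p
    rw [hWeq]
    simp only [hessDevFlat_apply, PiLp.add_apply, PiLp.smul_apply, smul_eq_mul]
    exact hessDev_const_smul_add hGAs hGBs ν p.1 p.2 x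
  -- differentiate under the integral with the `C¹` weight `‖·‖^q`
  have hΦ : ContDiff ℝ 1 (fun w : EuclideanSpace ℝ (d × d) => ‖w‖ ^ q) := contDiff_norm_rpow hq
  have hD := C1Weight.hasDerivWithinAt_integral_comp_fderiv_of_contDiff hab hθ hΦ ht
  have efun : (fun s => torusPidevMoment q (u s)) = fun s => ∫ x, ‖pidevFlat (u s) x‖ ^ q := by
    funext s; exact torusPidevMoment_eq_integral_norm_rpow q (u s)
  rw [efun]
  refine hD.congr_deriv ?_
  have hcF : Continuous fun x => fderiv ℝ (fun w : EuclideanSpace ℝ (d × d) => ‖w‖ ^ q) (pidevFlat (u t) x) :=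
    (hΦ.continuous_fderiv one_ne_zero).comp (isSmooth_hessDevFlat hπ).continuous
  have iA : Integrable fun x => fderiv ℝ (fun w : EuclideanSpace ℝ (d × d) => ‖w‖ ^ q)
      (pidevFlat (u t) x) (hessDevFlat GA x) :=
    (hcF.clm_apply (isSmooth_hessDevFlat hGAs).continuous).integrable_unitAddTorus
  have iB : Integrable fun x => fderiv ℝ (fun w : EuclideanSpace ℝ (d × d) => ‖w‖ ^ q)
      (pidevFlat (u t) x) (hessDevFlat GB x) :=
    (hcF.clm_apply (isSmooth_hessDevFlat hGBs).continuous).integrable_unitAddTorus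
  have e1 : ∀ x, fderiv ℝ (fun w : EuclideanSpace ℝ (d × d) => ‖w‖ ^ q) (pidevFlat (u t) x)
      (Torus.timeDerivWithin (Icc a b) (fun s => pidevFlat (u s)) t x) =
      ν * fderiv ℝ (fun w : EuclideanSpace ℝ (d × d) => ‖w‖ ^ q) (pidevFlat (u t) x) (hessDevFlat GA x) +
        fderiv ℝ (fun w : EuclideanSpace ℝ (d × d) => ‖w‖ ^ q) (pidevFlat (u t) x) (hessDevFlat GB x) := by
    intro x
    rw [hDθ x, hHW x, map_add, map_smul, smul_eq_mul]
  simp_rw [e1]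
  rw [integral_add (iA.const_mul ν) iB, integral_const_mul]
  simp_rw [← pidevRpowIntegrand_eq_fderiv hq]
  rw [pidevRpowViscousRate, pidevRpowInertialRate, hGA, hGB]
  ring

/-- **The initial rates of the rows `EP.Pidev.q`, real `q > 1`**:
`HasInitialRate (torusPidevMoment q) N_q V_q` on `T³`. [ours] -/
theorem hasInitialRate_torusPidevMoment_rpow {q : ℝ} (hq : 1 < q) :
    HasInitialRate (d := d) (torusPidevMoment q) (pidevRpowInertialRate q) (pidevRpowViscousRate q) := by
  intro hd ν _ a b hab u p hsol _
  haveI : Nonempty d := Fintype.card_pos_iff.mp (by omega)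
  exact hasDerivWithinAt_torusPidevMoment_rpow hq hsol hab (left_mem_Icc.2 hab.le)

end Summit.NavierStokesRegularity.FunctionalMining
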